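/-
Origin: expansion seat `planner-pub-hodgecm-pv12-0`, handover 2026-08-18T03:56:33Z (`HOME/pub-hodgecm-pv12/lean/Pv12/ArchBGen.lean`, md5 6045a519, 273 lines);
landed by the gen-5 packager in gate run 20 as `HodgeCM/PerL34/ArchBGen.lean` (import ^import Pv[0-9]+\.→import HodgeCM.PerL34. ×1).
-/
/-
Origin: HOME/pub-hodgecm-pv12/lean/Pv12/ArchBGen.lean — session planner-pub-hodgecm-pv12-0 (unit pub-hodgecm-pv12,
DAG-node prover #12).  D5 Fock layer, part 3: node N28 = Lemma 4.1(b) in the FORMAT CONSUMED BY NODE N29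
(`HodgeCM/PerL34/ArchC.lean`, seat pv06: the `[NODE N28]` fields `ArchCDatum.gen`, `ArchCDatum.φ₀_eigen`).
Intended final place `HodgeCM/PerL34/ArchBGen.lean`; imports `Pv12.ArchB` (→ `HodgeCM.PerL34.ArchB`) and one
Mathlib file; asserts nothing.
-/
import Summits.HodgeConjecture.HodgeCM.PerL34.ArchB
import Mathlib.LinearAlgebra.TensorProduct.Basic

set_option autoImplicit false
set_option linter.unusedSectionVars false

/-!
# Lemma 4.1(b) in N29's format: "the only `𝔲(W)`-stable submodule of `𝓕^κ` containing `φ⁰` is everything"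

Node N29 (`HodgeCM/PerL34/ArchC.lean`, landed run 18) proves Lemma 4.1(c) over a datum `ArchCDatum` whose two
`[NODE N28]` hypothesis fields are, verbatim,

  `gen : ∀ N : Submodule ℂ F, φ₀ ∈ N → (∀ k, ∀ φ ∈ N, X k φ ∈ N) → N = ⊤`
  `φ₀_eigen : ∀ t : Tg, ωT t φ₀ = (w t)⁻¹ • φ₀`

with `F = 𝓕^κ_∞ := ⊗_b 𝓕^{κ_b}_b`, `X` a spanning family of `𝔲(W)(L₀⊗ℝ)_ℂ = ⊕_b 𝔲(W_b)_ℂ` acting factorwise, and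
`φ₀ = ⊗_b φ⁰_b` (tex ll. 483–486, 500, 505, 510).  This file supplies, KERNEL-PROVED:

* `IsGeneratedBy X φ₀` — the predicate of the field `gen`, by name;
* `isGeneratedBy_tmul` — generation is multiplicative: if `(M, X, m₀)` and `(N, Y, n₀)` are generated then so is
  `(M ⊗ N, X ⊗ 1 ⊔ 1 ⊗ Y, m₀ ⊗ n₀)`; iterating over the real places reduces `gen` to the LOCAL statements;
* the LOCAL statements in the three explicit models of `Pv12/ArchB.lean`, each over the local `κ_b`-part as a
  module in its own right (a `Submodule` subtype), for ANY operator family containing the relevant generator of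
  `𝔲(W_b)_ℂ`:
  (E) equal signs: `kappaPartE = ℂ·1` (`mem_kappaPartE_iff`, from `eq_C_of_eqTorus`), `isGeneratedBy_E`;
  (M) opposite signs, `b ≠ ι₁`: `kappaPartM = ℂ[P] = {U(3)-invariants}` (`mem_kappaPartM_iff` = `isU3Invariant_iff`),
      `isGeneratedBy_M`: generated by `1` under any family containing the raising operator `c_b·(P·_)`, `c_b ≠ 0`
      (tex l. 503–504);
  (I) `b = ι₁`: `kappaPartI = ℂ·det(z) = {κ-vectors}` (`mem_kappaPartI_iff` = `isKappaVector_iff`), `isGeneratedBy_I`.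
* For `φ₀_eigen` the polynomial parts are `ArchB.weightOp_one` (cases E, M: the torus of `U(W_b)` acts on `1` by the
  vacuum character alone) and `ArchB.columnSubst_detZ` with `g = diag(u₁,u₂)` (case I: `det(z) ↦ u₁u₂·det(z)`),
  `ArchB.weightOp_colWt_detZ` (infinitesimally); the vacuum characters themselves are node N26's `e_b` (Dictionary).

What remains OUTSIDE the kernel is, as for `ArchB.lean`, only the Dictionary (LEMMAS §3 D5; GAPS `pv12/N28`): that
`ArchCDatum.F`, `X`, `φ₀` of the intended model ARE `⊗_b kappaPart_b` with these operators and generators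
(Adams 2007 Def. 2.7/§4/Prop. 6.6; Borel–Wallach VIII §2 — print, quoted in `ArchB.lean`).
-/

namespace HodgeCM

namespace PerL34

namespace Fock

open MvPolynomial Finsupp

open scoped BigOperators TensorProduct

/-! ## 1. The predicate of `ArchCDatum.gen` and its multiplicativity under `⊗` -/

section Abstract

/-- `ArchCDatum.gen`'s content as a predicate: the only `X`-stable submodule containing `φ₀` is `⊤`
("generated by `φ₀` as a module over the algebra generated by the `X k`"). -/
def IsGeneratedBy {F : Type*} [AddCommGroup F] [Module ℂ F] {ι : Type*} (X : ι → F →ₗ[ℂ] F) (φ₀ : F) : Prop :=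
  ∀ S : Submodule ℂ F, φ₀ ∈ S → (∀ k, ∀ φ ∈ S, X k φ ∈ S) → S = ⊤

variable {M N : Type*} [AddCommGroup M] [Module ℂ M] [AddCommGroup N] [Module ℂ N]

/-- A line is generated by any non-trivial vector under any operator family (cases E and I below). -/
theorem isGeneratedBy_of_span_singleton (v : M) {ι : Type*}
    (X : ι → ↥(Submodule.span ℂ ({v} : Set M)) →ₗ[ℂ] ↥(Submodule.span ℂ ({v} : Set M))) :
    IsGeneratedBy X ⟨v, Submodule.mem_span_singleton_self v⟩ := by
  intro S hv _
  rw [eq_top_iff]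
  rintro ⟨x, hx⟩ -
  obtain ⟨a, rfl⟩ := Submodule.mem_span_singleton.mp hx
  have : (⟨a • v, hx⟩ : ↥(Submodule.span ℂ ({v} : Set M))) = a • ⟨v, Submodule.mem_span_singleton_self v⟩ :=
    rfl
  rw [this]
  exact S.smul_mem a hv

/-- **Generation is multiplicative under `⊗`** ("`U(⊕_b 𝔲_b) = ⊗_b U(𝔲_b)` acting factorwise on `⊗_b 𝓕^κ_b`",
the 'jointly over the real places' clause of `ArchCDatum.gen`): if `M` is generated by `m₀` under `X` and `N` by
`n₀` under `Y`, then `M ⊗ N` is generated by `m₀ ⊗ n₀` under the family `X k ⊗ 1`, `1 ⊗ Y l`. -/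
theorem isGeneratedBy_tmul {ι κ : Type*} {X : ι → M →ₗ[ℂ] M} {Y : κ → N →ₗ[ℂ] N} {m₀ : M} {n₀ : N}
    (hM : IsGeneratedBy X m₀) (hN : IsGeneratedBy Y n₀) :
    IsGeneratedBy (Sum.elim (fun k => (X k).rTensor N) (fun l => (Y l).lTensor M)) (m₀ ⊗ₜ[ℂ] n₀) := by
  intro S h0 hS
  have step1 : ∀ m : M, m ⊗ₜ[ℂ] n₀ ∈ S := by
    have h := hM (S.comap ((TensorProduct.mk ℂ M N).flip n₀)) (by simpa using h0) ?_
    · intro m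
      have hm : m ∈ (⊤ : Submodule ℂ M) := Submodule.mem_top
      rw [← h] at hm
      simpa using hm
    · intro k φ hφ
      simp only [Submodule.mem_comap, LinearMap.flip_apply, TensorProduct.mk_apply] at hφ ⊢
      simpa using hS (Sum.inl k) _ hφ
  have step2 : ∀ (m : M) (n : N), m ⊗ₜ[ℂ] n ∈ S := by
    intro m
    have h := hN (S.comap (TensorProduct.mk ℂ M N m)) (by simpa using step1 m) ?_
    · intro n
      have hn : n ∈ (⊤ : Submodule ℂ N) := Submodule.mem_top
      rw [← h] at hn
      simpa using hn
    · intro l φ hφ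
      simp only [Submodule.mem_comap, TensorProduct.mk_apply] at hφ ⊢
      simpa using hS (Sum.inr l) _ hφ
  rw [eq_top_iff, ← TensorProduct.span_tmul_eq_top, Submodule.span_le]
  rintro _ ⟨m, n, rfl⟩
  exact step2 m n

/-- From an ambient generation statement to the subtype form: if every `X`-stable submodule of `V` containing
`φ₀` contains `K` (and the `X k` preserve `K`), then `K` is generated by `φ₀` under the restricted operators. -/
theorem isGeneratedBy_restrict {V : Type*} [AddCommGroup V] [Module ℂ V] {ι : Type*} (K : Submodule ℂ V)
    (X : ι → V →ₗ[ℂ] V) (hX : ∀ k, ∀ v ∈ K, X k v ∈ K) {φ₀ : V} (h₀ : φ₀ ∈ K)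
    (hgen : ∀ S : Submodule ℂ V, φ₀ ∈ S → (∀ k, ∀ φ ∈ S, X k φ ∈ S) → K ≤ S) :
    IsGeneratedBy (fun k => (X k).restrict (hX k)) (⟨φ₀, h₀⟩ : ↥K) := by
  intro S hS0 hS
  have hle := hgen (S.map K.subtype) ⟨⟨φ₀, h₀⟩, hS0, rfl⟩ (by
    rintro k _ ⟨x, hx, rfl⟩
    exact ⟨(X k).restrict (hX k) x, hS k x hx, rfl⟩)
  rw [eq_top_iff]
  rintro x -
  obtain ⟨y, hy, hyx⟩ := hle x.2
  have : y = x := Subtype.ext hyx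
  rwa [this] at hy

end Abstract

/-! ## 2. Case E (equal signs): `𝓕^κ_b = 𝓕_b^{U(3)} = ℂ·1` -/

section CaseE

/-- The local `κ_b = 𝟏 ⊠ 𝟏`-part in case E: the line of constants.  (By `eq_C_of_eqTorus` the `U(3)`-torus
invariants of `ℂ[M_{3×2}]` are already the constants, and constants are killed by every `z·∂`, so this IS the
`U(3)`-invariant = `𝟏`-isotypic part: `mem_kappaPartE_iff`.) -/
noncomputable def kappaPartE : Submodule ℂ EqModel := Submodule.span ℂ {(1 : EqModel)}

/-- (Ported verbatim from the HodgeCMPerL package; no docstring in the source.) -/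
theorem mem_kappaPartE_iff (f : EqModel) : f ∈ kappaPartE ↔ ∀ a, weightOp (eqTorWt a) f = 0 := by
  rw [kappaPartE, Submodule.mem_span_singleton]
  constructor
  · rintro ⟨c, rfl⟩ a
    rw [map_smul, weightOp_one, smul_zero]
  · intro h
    refine ⟨coeff 0 f, ?_⟩
    rw [smul_eq_C_mul, mul_one]
    exact (eq_C_of_eqTorus f h).symm

/-- **Case E of `ArchCDatum.gen`, locally**: `𝓕^κ_b = ℂ·1` is generated by `φ⁰_b := 1` under ANY operator
family (tex l. 500: "generated by `φ⁰_b := 1`"). -/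
theorem isGeneratedBy_E {ι : Type*} (X : ι → ↥kappaPartE →ₗ[ℂ] ↥kappaPartE) :
    IsGeneratedBy X ⟨1, Submodule.mem_span_singleton_self _⟩ :=
  isGeneratedBy_of_span_singleton (M := EqModel) 1 X

end CaseE

/-! ## 3. Case M (opposite signs, `b ≠ ι₁`): `𝓕^κ_b = ℂ[P]`, generated by `1` under `c_b·(P·_)` -/

section CaseM

/-- The local `κ_b = 𝟏_{U(3)}`-part in case M: `ℂ[P] = span{P^k}` = the `U(3)`-invariants (`isU3Invariant_iff`). -/
noncomputable def kappaPartM : Submodule ℂ MixedModel := Submodule.span ℂ (Set.range fun k : ℕ => P ^ k)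

/-- (Ported verbatim from the HodgeCMPerL package; no docstring in the source.) -/
theorem mem_kappaPartM_iff (f : MixedModel) : f ∈ kappaPartM ↔ IsU3Invariant f :=
  (isU3Invariant_iff f).symm

/-- (Ported verbatim from the HodgeCMPerL package; no docstring in the source.) -/
theorem P_pow_mem_kappaPartM (k : ℕ) : P ^ k ∈ kappaPartM := Submodule.subset_span ⟨k, rfl⟩

/-- (Ported verbatim from the HodgeCMPerL package; no docstring in the source.) -/
theorem one_mem_kappaPartM : (1 : MixedModel) ∈ kappaPartM := by
  simpa using P_pow_mem_kappaPartM 0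

/-- `ℂ[P]` is stable under multiplication by `P` (the raising operator `𝔭'₊` up to `c_b`). -/
theorem P_mul_mem_kappaPartM {f : MixedModel} (hf : f ∈ kappaPartM) : P * f ∈ kappaPartM := by
  have : kappaPartM.map (LinearMap.mulLeft ℂ P) ≤ kappaPartM := by
    rw [kappaPartM, Submodule.map_span_le]
    rintro _ ⟨k, rfl⟩
    change P * P ^ k ∈ kappaPartM
    simpa [pow_succ'] using P_pow_mem_kappaPartM (k + 1)
  exact this ⟨f, hf, rfl⟩

/-- Ambient form: every submodule of the model containing `1` and stable under `f ↦ c_b·P·f` (`c_b ≠ 0`) contains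
`ℂ[P]` (tex ll. 503–504: "`𝔭'₊·P^k ∈ ℂ^× P^{k+1}`, so `ℂ[P] = U(𝔭'₊)·1`"). -/
theorem kappaPartM_le_of_stable (cb : ℂ) (hcb : cb ≠ 0) (S : Submodule ℂ MixedModel) (h1 : (1 : MixedModel) ∈ S)
    (hS : ∀ φ ∈ S, cb • (P * φ) ∈ S) : kappaPartM ≤ S := by
  have hpow : ∀ k, P ^ k ∈ S := by
    intro k
    induction k with
    | zero => simpa using h1
    | succ k ih =>
      have := S.smul_mem cb⁻¹ (hS _ ih)
      rwa [smul_smul, inv_mul_cancel₀ hcb, one_smul, ← pow_succ'] at this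
  rw [kappaPartM, Submodule.span_le]
  rintro _ ⟨k, rfl⟩
  exact hpow k

/-- **Case M of `ArchCDatum.gen`, locally**: `𝓕^κ_b = ℂ[P]` is generated by `φ⁰_b := 1` under any operator family
on it one member of which is the raising operator `c_b·(P·_)`, `c_b ≠ 0`. -/
theorem isGeneratedBy_M {ι : Type*} (X : ι → ↥kappaPartM →ₗ[ℂ] ↥kappaPartM) (cb : ℂ) (hcb : cb ≠ 0) (k₀ : ι)
    (hX : ∀ φ : ↥kappaPartM, ((X k₀ φ : ↥kappaPartM) : MixedModel) = cb • (P * φ)) :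
    IsGeneratedBy X ⟨1, one_mem_kappaPartM⟩ := by
  intro S h1 hS
  -- the image of `S` in the model contains `1` and is stable under the raising operator, hence contains `ℂ[P]`
  have hle : kappaPartM ≤ S.map kappaPartM.subtype := by
    refine kappaPartM_le_of_stable cb hcb _ ⟨_, h1, rfl⟩ ?_
    rintro _ ⟨φ, hφ, rfl⟩
    exact ⟨X k₀ φ, hS k₀ φ hφ, by simp [hX]⟩
  rw [eq_top_iff]
  rintro x -
  obtain ⟨y, hy, hyx⟩ := hle x.2
  have : y = x := Subtype.ext hyx
  rwa [this] at hy

end CaseM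

/-! ## 4. Case I (`b = ι₁`): `𝓕^κ_{ι₁} = ℂ·det(z)` -/

section CaseI

/-- The local `κ = (1,1;−2)`-part at `ι₁`: the line `ℂ·det(z)` = the `κ`-vectors (`isKappaVector_iff`). -/
noncomputable def kappaPartI : Submodule ℂ PlaneModel := Submodule.span ℂ {detZ}

/-- (Ported verbatim from the HodgeCMPerL package; no docstring in the source.) -/
theorem mem_kappaPartI_iff (f : PlaneModel) : f ∈ kappaPartI ↔ IsKappaVector f := by
  rw [kappaPartI, Submodule.mem_span_singleton, isKappaVector_iff]
  constructor
  · rintro ⟨a, rfl⟩; exact ⟨a, rfl⟩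
  · rintro ⟨a, rfl⟩; exact ⟨a, rfl⟩

/-- `𝔲(2)_W` preserves `ℂ·det(z)`: the roots kill it … -/
theorem EW_mem_kappaPartI (j j' : Fin 2) (hjj' : j ≠ j') {f : PlaneModel} (hf : f ∈ kappaPartI) :
    EW j j' f ∈ kappaPartI := by
  obtain ⟨a, rfl⟩ := Submodule.mem_span_singleton.mp hf
  rw [map_smul, EW_detZ j j' hjj', smul_zero]
  exact Submodule.zero_mem _

/-- … and the column torus acts diagonally. -/
theorem weightOp_colWt_mem_kappaPartI (j : Fin 2) {f : PlaneModel} (hf : f ∈ kappaPartI) :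
    weightOp (colWt j) f ∈ kappaPartI := by
  obtain ⟨a, rfl⟩ := Submodule.mem_span_singleton.mp hf
  rw [map_smul, weightOp_colWt_detZ]
  exact hf

/-- **Case I of `ArchCDatum.gen`, locally**: `𝓕^κ_{ι₁} = ℂ·det(z)` is generated by `φ⁰_{ι₁} := det(z)` under any
operator family (tex ll. 509–510). -/
theorem isGeneratedBy_I {ι : Type*} (X : ι → ↥kappaPartI →ₗ[ℂ] ↥kappaPartI) :
    IsGeneratedBy X ⟨detZ, Submodule.mem_span_singleton_self _⟩ :=
  isGeneratedBy_of_span_singleton (M := PlaneModel) detZ X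

end CaseI

/-! ## 5. Summary in N29's format -/

/-- **N28 ⇒ the `[NODE N28]` field `ArchCDatum.gen` of N29, modulo the Dictionary.**  Locally at each real place the
`κ_b`-part of the explicit model is generated by PerL's `φ⁰_b` under (any family containing) the `𝔲(W_b)_ℂ`
generator, in exactly the format `∀ S, φ₀ ∈ S → (∀ k, ∀ φ ∈ S, X k φ ∈ S) → S = ⊤`; and the format is
multiplicative under `⊗` (`isGeneratedBy_tmul`), which assembles the places. -/
theorem N28_gen_kernel :
    (∀ {ι : Type} (X : ι → ↥kappaPartE →ₗ[ℂ] ↥kappaPartE),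
        IsGeneratedBy X ⟨1, Submodule.mem_span_singleton_self _⟩) ∧
    (∀ {ι : Type} (X : ι → ↥kappaPartM →ₗ[ℂ] ↥kappaPartM) (cb : ℂ), cb ≠ 0 → ∀ k₀ : ι,
        (∀ φ : ↥kappaPartM, ((X k₀ φ : ↥kappaPartM) : MixedModel) = cb • (P * φ)) →
        IsGeneratedBy X ⟨1, one_mem_kappaPartM⟩) ∧
    (∀ {ι : Type} (X : ι → ↥kappaPartI →ₗ[ℂ] ↥kappaPartI),
        IsGeneratedBy X ⟨detZ, Submodule.mem_span_singleton_self _⟩) ∧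
    (∀ {M N : Type} [AddCommGroup M] [Module ℂ M] [AddCommGroup N] [Module ℂ N] {ι κ : Type}
        {X : ι → M →ₗ[ℂ] M} {Y : κ → N →ₗ[ℂ] N} {m₀ : M} {n₀ : N},
        IsGeneratedBy X m₀ → IsGeneratedBy Y n₀ →
        IsGeneratedBy (Sum.elim (fun k => (X k).rTensor N) (fun l => (Y l).lTensor M)) (m₀ ⊗ₜ[ℂ] n₀)) :=
  ⟨fun X => isGeneratedBy_E X, fun X cb hcb k₀ hX => isGeneratedBy_M X cb hcb k₀ hX, fun X => isGeneratedBy_I X,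
    fun hM hN => isGeneratedBy_tmul hM hN⟩

end Fock

end PerL34

end HodgeCM
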